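import Summits.AtomisticToContinuum.Crystallization.Theorems.ExcessDecayLiouvilleHcpLiouvilleAnchorNewton

/-!
# `ExcessDecayLiouville.HcpLiouville` (stmt-AtomisticToContinuum-9332), line `Sketch` v5: the symmetric shift

Stub `stub_symmetricShift` of skeleton v5 of the line `Sketch` (crux `HcpLiouville`).  One input of the
line is that every admissible cell `A` has a RELAXED inner shift: a zero `e` of the optical force
`g_A(e) = Σ'_{z ∈ Λ₀} F(e + Az)`, `F(x) = (V′(|x|)/|x|)·x`, `V = lennardJones`, within `1/40` of the
geometric shift `A m`, `m = w₀ + √(2/3)e₃`.  This file settles it EXACTLY (`e = A m`) for cells with hcp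
symmetry: if two linear maps `R`, `M` permute `Λ₀`, move the motif point `m` by lattice vectors, have no
common fixed vector but `0`, and are intertwined by `A` with linear isometries (`A ∘ R = T ∘ A`,
`A ∘ M = T′ ∘ A`), then `g_A(A m) = 0` in the `HasSum` form.

Proof.  The family `f z = F(A m + A z)` is summable (`summable_optForce_of_mem`), say with sum `S`.
(1) `F` is equivariant under linear isometries, `F(T x) = T(F x)`.  (2) With `l = R m − m ∈ Λ₀` the map
`σ z = R z + l` is a bijection of `Λ₀`, and `T(f z) = F(T(A(m + z))) = F(A(R(m + z))) = F(A(m + σ z)) = f(σ z)`;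
hence `HasSum (f ∘ σ) (T S)`, i.e. `HasSum f (T S)` (`Equiv.hasSum_iff`), so `T S = S`; likewise `T′ S = S`
(`apply_tsum_eq_of_symmetry`).  (3) `A` is onto (`surjective_of_adm₀`), `S = A y`, and
`A(R y) = T(A y) = A y` gives `R y = y` by injectivity (`injective_of_adm₀`), likewise `M y = y`, so `y = 0`
and `S = 0`.  All `[folklore]`; a `--supports` helper for item stmt-AtomisticToContinuum-9332, nothing here
closes an item.
-/

noncomputable section

namespace Summit.AtomisticToContinuum.Crystallization.Theorems.ExcessDecayLiouville

open scoped BigOperators Topology Classical InnerProductSpace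
open Literature.MathematicalPhysics.StatisticalMechanics
open Summit.AtomisticToContinuum.Crystallization.Theses.ExcessDecayLiouville
open Summit.AtomisticToContinuum.Crystallization.Theorems.PhononStabilityNegative

local notation "E3" => EuclideanSpace ℝ (Fin 3)

/-! ## Equivariance of the pair force -/

/-- **The Lennard-Jones pair force is equivariant under linear isometries**:
`F(T x) = T(F x)` for `F(x) = (V′(|x|)/|x|)·x`. [folklore] -/
theorem ljForce_map_linearIsometryEquiv (T : E3 ≃ₗᵢ[ℝ] E3) (x : E3) :
    (deriv lennardJones ‖T x‖ / ‖T x‖) • T x = T ((deriv lennardJones ‖x‖ / ‖x‖) • x) := by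
  rw [LinearIsometryEquiv.norm_map, LinearIsometryEquiv.map_smul]

/-! ## A lattice symmetry fixes the optical force -/

section

variable {A R : E3 →L[ℝ] E3}

/-- **A translated lattice automorphism is a bijection of `Λ₀`**: if `R` maps `Λ₀` bijectively onto
itself and `l ∈ Λ₀`, then so does `z ↦ R z + l`. [folklore] -/
theorem bijOn_add_of_bijOn (hR : Set.BijOn R Λ₀ Λ₀) {l : E3} (hl : l ∈ Λ₀) :
    Set.BijOn (fun z : E3 => R z + l) Λ₀ Λ₀ := by
  refine ⟨fun z hz => hcpLiouvilleLam_add_mem (hR.mapsTo hz) hl, ?_, ?_⟩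
  · intro z hz z' hz' h
    exact hR.injOn hz hz' (add_right_cancel h)
  · intro w hw
    obtain ⟨z, hz, hz'⟩ := hR.surjOn (hcpLiouvilleLam_sub_mem hw hl)
    exact ⟨z, hz, by simp only [hz', sub_add_cancel]⟩

/-- **A lattice symmetry of the cell fixes the optical force at the geometric shift.**  If `R` permutes
`Λ₀`, moves the motif point `m = w₀ + √(2/3)e₃` by a lattice vector, and `A ∘ R = T ∘ A` for a linear
isometry `T`, then every sum `S` of the optical force family `z ↦ F(A m + A z)` satisfies `T S = S`
(reindex the family by the bijection `z ↦ R z + (R m − m)` of `Λ₀`). [folklore] -/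
theorem apply_eq_of_hasSum_optForce (hR : Set.BijOn R Λ₀ Λ₀)
    (hRm : R (barlowOffset 1 + layerNormal (Real.sqrt (2 / 3))) -
      (barlowOffset 1 + layerNormal (Real.sqrt (2 / 3))) ∈ Λ₀)
    (T : E3 ≃ₗᵢ[ℝ] E3) (hT : ∀ x : E3, A (R x) = T (A x)) {S : E3}
    (hS : HasSum (fun z : Λ₀ =>
      (deriv lennardJones ‖A (barlowOffset 1 + layerNormal (Real.sqrt (2 / 3))) + A z‖ /
          ‖A (barlowOffset 1 + layerNormal (Real.sqrt (2 / 3))) + A z‖) •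
        (A (barlowOffset 1 + layerNormal (Real.sqrt (2 / 3))) + A z)) S) :
    T S = S := by
  set m : E3 := barlowOffset 1 + layerNormal (Real.sqrt (2 / 3)) with hm
  set l : E3 := R m - m with hl
  set f : Λ₀ → E3 := fun z => (deriv lennardJones ‖A m + A z‖ / ‖A m + A z‖) • (A m + A z) with hf
  -- the reindexing bijection `σ z = R z + l`
  set σ : Λ₀ ≃ Λ₀ := (bijOn_add_of_bijOn hR hRm).equiv _ with hσ
  have hσ' : ∀ z : Λ₀, ((σ z : Λ₀) : E3) = R z + l := fun z => rfl
  -- `T (A m + A z) = A m + A (σ z)`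
  have key : ∀ z : Λ₀, T (A m + A z) = A m + A (σ z) := by
    intro z
    rw [hσ', ← map_add, ← map_add, ← hT, map_add, hl]
    congr 1
    abel
  -- `T ∘ f = f ∘ σ`
  have hcomp : (fun z : Λ₀ => T (f z)) = f ∘ σ := by
    funext z
    simp only [Function.comp_apply, hf]
    rw [← ljForce_map_linearIsometryEquiv, key]
  have h1 : HasSum (fun z : Λ₀ => T (f z)) (T S) :=
    hS.mapL (T.toContinuousLinearEquiv : E3 →L[ℝ] E3)
  rw [hcomp, Equiv.hasSum_iff] at h1
  exact h1.unique hS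

end

/-! ## The stub -/

/-- **Stub `stub_symmetricShift` (line `Sketch` v5, crux `HcpLiouville`)**: for an admissible cell `A`
intertwining two lattice symmetries `R`, `M` of `Λ₀` (each moving the motif point `m = w₀ + √(2/3)e₃` by a
lattice vector, with only the common fixed vector `0`) with linear isometries, the geometric shift `A m`
is an EXACT zero of the optical force: `Σ'_{z ∈ Λ₀} F(A m + A z) = 0` in `HasSum` form.  (The sum `S` is
fixed by both isometries; pulling back through the bijective `A`, `S = A y` with `R y = y = M y`, so
`y = 0`.) [folklore] -/
theorem stub_symmetricShift :
    ∀ (A R M : E3 →L[ℝ] E3), Adm₀ A →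
      Set.BijOn R Λ₀ Λ₀ → R (barlowOffset 1 + layerNormal (Real.sqrt (2 / 3))) - (barlowOffset 1 + layerNormal (Real.sqrt (2 / 3))) ∈ Λ₀ →
      Set.BijOn M Λ₀ Λ₀ → M (barlowOffset 1 + layerNormal (Real.sqrt (2 / 3))) - (barlowOffset 1 + layerNormal (Real.sqrt (2 / 3))) ∈ Λ₀ →
      (∀ y : E3, R y = y → M y = y → y = 0) →
      (∃ T : E3 ≃ₗᵢ[ℝ] E3, ∀ x : E3, A (R x) = T (A x)) → (∃ T : E3 ≃ₗᵢ[ℝ] E3, ∀ x : E3, A (M x) = T (A x)) →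
      HasSum (fun z : Λ₀ =>
        (deriv lennardJones ‖A (barlowOffset 1 + layerNormal (Real.sqrt (2 / 3))) + A z‖ /
            ‖A (barlowOffset 1 + layerNormal (Real.sqrt (2 / 3))) + A z‖) •
          (A (barlowOffset 1 + layerNormal (Real.sqrt (2 / 3))) + A z)) 0 := by
  intro A R M hA hR hRm hM hMm hfix hT hT'
  obtain ⟨T, hT⟩ := hT
  obtain ⟨T', hT'⟩ := hT'
  obtain ⟨S, hS⟩ := summable_optForce_of_mem hA
    (e := A (barlowOffset 1 + layerNormal (Real.sqrt (2 / 3)))) (by rw [sub_self, norm_zero]; norm_num)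
  have hTS : T S = S := apply_eq_of_hasSum_optForce hR hRm T hT hS
  have hT'S : T' S = S := apply_eq_of_hasSum_optForce hM hMm T' hT' hS
  obtain ⟨y, rfl⟩ := surjective_of_adm₀ hA S
  have hRy : R y = y := injective_of_adm₀ hA (by rw [hT, hTS])
  have hMy : M y = y := injective_of_adm₀ hA (by rw [hT', hT'S])
  rwa [hfix y hRy hMy, map_zero] at hS

end Summit.AtomisticToContinuum.Crystallization.Theorems.ExcessDecayLiouville
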